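/-
Copyright (c) 2026 the pub-hodgecm-mathlib formalisation cell (harness21).  Prover seat hodgecm-mathlib-K2Liu-p03 (g9), Track B «K2-LIT» ∕ hLiu418 #184♮ =
`stmt-HodgeConjecture-24832`, socket #41 KIND 1, block K1-b♮ (dec-2-pay) F3 (pull-back brick): «THE PULL-BACK `u ↦ Φ(B_v(u)·x)` OF A LOCAL SIEGEL SECTION OF THE BIG
GROUP ALONG THE LOCAL CORNER CHART IS A SMOOTH LOCAL SIEGEL SECTION OF THE LINE, OF WEIGHT `s + n₁∕2`».  THEOREMS ONLY (no `def`, no `instance`, no notation, no named-fact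
hypothesis, no `sorry`); lane `--supports stmt-HodgeConjecture-24832 --as helper`.
-/
import Summits.HodgeConjecture.HodgeConjecture.Theorems.K2LiuKindOneLineLocalPullback      -- ★ (e3-loc): `cornerLoc_mul`, `cornerLoc_mem_siegelDeltaLoc`, `siegelCharLoc_cornerLoc`
import Literature.NumberTheory.GelbartRogawski1991.DoubledBlockDiagEmbedding               -- ★ `continuous_blkD`
import Literature.NumberTheory.Automorphic.UnitaryGroupPlaceInclusion                      -- ★ `continuous_inclPlaceAdelic`
import Literature.NumberTheory.Automorphic.UnitaryGroupRestrictedProduct                   -- ★ `continuous_evalPlace`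
import Literature.NumberTheory.Automorphic.UnitaryGroupAdelicProduct                       -- ★ `continuous_finPart`
import HarnessLib

/-!
# Crux `HLiu418`, socket #41, KIND 1 b♮ (dec-2-pay) F3 — `K2LiuKindOneLineLocalPullbackSection`: `u ↦ Φ(B_v(u)·x)` IS A SMOOTH SIEGEL SECTION OF `I^{(B)}_v(s + n₁∕2, χ_v)`

Cell `hodgecm-mathlib`, crux item hLiu418 = `stmt-HodgeConjecture-24832` (helper lane, count-neutral).  Namespace `…Cruxes.HLiu418.K2LiuKindOneLineLocalPullbackSection`.
WHY.  The K1-b♮ line's local factors at a place `v ∈ T′` are `u ↦ Φ_v(B_v(u)·g_v)` (★ `isFactorizableOff_cornerTranslate`: `Φ_v = Λ^{(V)}_{s,v}` off `S₀`, a flat twist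
`H_v^{2(s−s₀)}·b ∈ I_v(s, χ_v)` on `S₀` — ★ `exists_kindW_factorization`; `B_v(u) = (blkD(1, ι_v u))_v` the local corner chart of ★ `K2LiuKindOneLineLocalPullback`, `g_v` the
translate's component).  ★ F3-loc `K2LiuKindOneLineLocalAbsoluteMajorant` (absolute majorant of the line's local integral, every finite place) and F2γ's (M5) local `hint`
letters take such a factor as a SMOOTH local Siegel section of the LINE (★ D10 `IsLocalSiegelSection` + `IsSmooth` at the line datum `(eB, dB, dW)`).  THIS FILE proves exactly
that, in the ★ D10 ∕ K2Lit local currency, from the ★ local modulus shift `σ^{(V)}_{χ,s,v}(B_v p) = σ^{(B)}_{χ,s+n₁∕2,v}(p)` (`siegelCharLoc_cornerLoc`), ★ `cornerLoc_mem_siegelDeltaLoc`,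
★ `mem_siegelDeltaLoc_iff_local`, ★ `siegelCharLoc_eq_localSiegelCharacter_of_mem` (§1), and the continuity of `B_v` (★ `continuous_evalPlace ∘ continuous_finPart ∘ continuous_blkD ∘
continuous_inclPlaceAdelic`) for the open level `B_v⁻¹(x·U·x⁻¹)` (§2):
* §1 **`isLocalSiegelSection_pullback`** — `Φ ∈ I^{(V)}_v(s, χ_v)` ⇒ `(u ↦ Φ(B_v(u)·x)) ∈ I^{(B)}_v(s + n₁∕2, χ_v)` (as Siegel sections);
* §2 `continuous_cornerLoc`, **`isSmooth_pullback`** — `Φ` smooth ⇒ the pull-back is smooth; **`pullback_mem_localDegPS`** — both.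
References: [Kudla1994, §2–§3, Thm. 3.1]; [KudlaRallis1994, §2]; [HarrisKudlaSweet1996, §1 (1.11)–(1.15)]; [Li1992, §3]; [BorelJacquet1979, §4.1]; [Casselman1980, §3].
HONEST LABEL: HC_CM is proved only modulo the 7 printed citations (2 remaining named inputs: hLiu418 = stmt-HodgeConjecture-24832, h413 = stmt-HodgeConjecture-24833) until rung 0
closes; count-neutral helper (`--supports stmt-HodgeConjecture-24832 --as helper`).
-/

set_option autoImplicit false
set_option linter.dupNamespace false -- the mandated namespace repeats `HodgeConjecture.HodgeConjecture`

noncomputable section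

open scoped Matrix
open NumberField IsDedekindDomain
open Literature.NumberTheory.Automorphic Literature.NumberTheory.GaloisRepresentations
open Literature.NumberTheory.GelbartRogawski1991 Literature.NumberTheory.GelbartRogawski1991.GRConstruction
open Literature.NumberTheory.GelbartRogawski1991.UnitaryDualPair
open Literature.NumberTheory.K2Lit Literature.NumberTheory.K2Lit.SiegelDoubled
open Summit.HodgeConjecture.HodgeConjecture.Cruxes.HLiu418.K2LiuKindOneLineLocalPullback (cornerLoc_mul cornerLoc_mem_siegelDeltaLoc siegelCharLoc_cornerLoc)

namespace Summit.HodgeConjecture.HodgeConjecture.Cruxes.HLiu418.K2LiuKindOneLineLocalPullbackSection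

variable (L : Type) [Field L] [NumberField L] [IsCMField L]
variable {N₁ N₂ M n n₁ n₂ : ℕ} (eV : Fin (N₁ + N₂) × Fin M ≃ Fin n) (eA : Fin N₁ × Fin M ≃ Fin n₁) (eB : Fin N₂ × Fin M ≃ Fin n₂)
  (dA : Fin N₁ → L) (hdA : ∀ i, IsCMField.complexConj L (dA i) = dA i)
  (dB : Fin N₂ → L) (hdB : ∀ i, IsCMField.complexConj L (dB i) = dB i)
  (dV : Fin (N₁ + N₂) → L) (hdV : ∀ i, IsCMField.complexConj L (dV i) = dV i)
  (hVA : ∀ i, dV (Fin.castAdd N₂ i) = dA i) (hVB : ∀ j, dV (Fin.natAdd N₁ j) = dB j)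
  (dW : Fin M → L) (hdW : ∀ i, IsCMField.complexConj L (dW i) = dW i)
  (v : HeightOneSpectrum (𝓞 (Fp L)))

/-! ## §1 The section law pulls back with the modulus shift `n₁∕2` -/

set_option maxHeartbeats 1600000 in -- MEASURED: the `locToAdelic = inclPlaceAdelic` ∕ `hermD = (gramD …).map` defeqs behind the statement time out at 200000 (★ `locToAdelic_cornerLoc`'s class); scoped
/-- **THE PULL-BACK OF A SIEGEL SECTION ALONG THE LOCAL CORNER CHART**: for a Siegel section `Φ` of `I^{(V)}_v(s, χ_v)` on the big group `H(L⁺_v)` (★ D10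
`IsLocalSiegelSection` for the family `χ_w := χ.localComponent w`) and any `x ∈ H(L⁺_v)`, the function `u ↦ Φ(B_v(u)·x)` on the line group `H^{(B)}(L⁺_v)` is a Siegel
section of `I^{(B)}_v(s + n₁∕2, χ_v)`: for `p ∈ P_Δ^{(B)}`, `B_v(p u) x = B_v(p)·(B_v(u) x)` with `B_v(p) ∈ P_Δ^{(V)}` (★ `cornerLoc_mem_siegelDeltaLoc`) and
`σ^{(V)}_s(B_v p) = σ^{(B)}_{s+n₁∕2}(p)` (★ `siegelCharLoc_cornerLoc`, read in D10's currency by ★ `siegelCharLoc_eq_localSiegelCharacter_of_mem`).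
[cite: Kudla1994, §2, Thm. 3.1] [cite: KudlaRallis1994, §2] [cite: HarrisKudlaSweet1996, §1 (1.15)] -/
theorem isLocalSiegelSection_pullback (χ : HeckeCharacter L) (s : ℂ)
    {Φ : UnitaryGroup.localPi L (IsCMField.complexConj L) (n + n) (hermD L eV dV hdV dW hdW) v → ℂ}
    (hΦ : LocalSiegelDoubled.IsLocalSiegelSection (Fp L) L (IsCMField.complexConj L) (complexConj_imagUnit L) (imagUnit_ne_zero L) (imagUnit_mul_self L)
      v n (gramR_isSymm L eV dV hdV dW hdW) (hermD_eq_map_gramD L eV dV hdV dW hdW) (fun w => χ.localComponent w.1) s Φ)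
    (x : UnitaryGroup.localPi L (IsCMField.complexConj L) (n + n) (hermD L eV dV hdV dW hdW) v) :
    LocalSiegelDoubled.IsLocalSiegelSection (Fp L) L (IsCMField.complexConj L) (complexConj_imagUnit L) (imagUnit_ne_zero L) (imagUnit_mul_self L)
      v n₂ (gramR_isSymm L eB dB hdB dW hdW) (hermD_eq_map_gramD L eB dB hdB dW hdW) (fun w => χ.localComponent w.1) (s + (n₁ : ℂ) / 2)
      (fun u => Φ (UnitaryGroup.evalPlace (Fp L) L (IsCMField.complexConj L) (n + n) (hermD L eV dV hdV dW hdW) v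
        (UnitaryGroup.finPart (Fp L) L (IsCMField.complexConj L) (n + n) (hermD L eV dV hdV dW hdW)
          (blkD L eV eA eB dA hdA dB hdB dV hdV hVA hVB dW hdW (1, locToAdelic L eB dB hdB dW hdW v u))) * x)) := by
  intro p hp u
  have hp' : p ∈ siegelDeltaLoc L eB dB hdB dW hdW v := (mem_siegelDeltaLoc_iff_local L eB dB hdB dW hdW v p).2 hp
  have hBp : UnitaryGroup.evalPlace (Fp L) L (IsCMField.complexConj L) (n + n) (hermD L eV dV hdV dW hdW) v
      (UnitaryGroup.finPart (Fp L) L (IsCMField.complexConj L) (n + n) (hermD L eV dV hdV dW hdW)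
        (blkD L eV eA eB dA hdA dB hdB dV hdV hVA hVB dW hdW (1, locToAdelic L eB dB hdB dW hdW v p))) ∈ siegelDeltaLoc L eV dV hdV dW hdW v :=
    cornerLoc_mem_siegelDeltaLoc L eV eA eB dA hdA dB hdB dV hdV hVA hVB dW hdW v hp'
  have hBp' := (mem_siegelDeltaLoc_iff_local L eV dV hdV dW hdW v _).1 hBp
  show Φ (_ * x) = _ * Φ (_ * x)
  rw [cornerLoc_mul L eV eA eB dA hdA dB hdB dV hdV hVA hVB dW hdW v p u, mul_assoc, hΦ _ hBp',
    ← siegelCharLoc_eq_localSiegelCharacter_of_mem L eV dV hdV dW hdW v χ s hBp, siegelCharLoc_cornerLoc L eV eA eB dA hdA dB hdB dV hdV hVA hVB dW hdW v χ s hp',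
    siegelCharLoc_eq_localSiegelCharacter_of_mem L eB dB hdB dW hdW v χ (s + (n₁ : ℂ) / 2) hp']

/-! ## §2 Continuity of the chart and smoothness of the pull-back -/

/-- **the local corner chart `u ↦ B_v(u) = (blkD(1, ι_v u))_v` is continuous** (★ `continuous_evalPlace`, ★ `continuous_finPart`, ★ `continuous_blkD`, ★ `continuous_inclPlaceAdelic`
— `locToAdelic v = inclPlaceAdelic v`). [cite: BorelJacquet1979, §4.1] [cite: Kudla1994, §2] -/
theorem continuous_cornerLoc :
    Continuous fun u : UnitaryGroup.localPi L (IsCMField.complexConj L) (n₂ + n₂) (hermD L eB dB hdB dW hdW) v =>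
      UnitaryGroup.evalPlace (Fp L) L (IsCMField.complexConj L) (n + n) (hermD L eV dV hdV dW hdW) v
        (UnitaryGroup.finPart (Fp L) L (IsCMField.complexConj L) (n + n) (hermD L eV dV hdV dW hdW)
          (blkD L eV eA eB dA hdA dB hdB dV hdV hVA hVB dW hdW (1, locToAdelic L eB dB hdB dW hdW v u))) := by
  have hι : Continuous (locToAdelic L eB dB hdB dW hdW v) :=
    UnitaryGroup.continuous_inclPlaceAdelic (Fp L) L (IsCMField.complexConj L) (n₂ + n₂) (hermD L eB dB hdB dW hdW) v
  exact (UnitaryGroup.continuous_evalPlace (Fp L) L (IsCMField.complexConj L) (n + n) (hermD L eV dV hdV dW hdW) v).comp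
    ((UnitaryGroup.continuous_finPart (Fp L) L (IsCMField.complexConj L) (n + n) (hermD L eV dV hdV dW hdW)).comp
      ((continuous_blkD L eV eA eB dA hdA dB hdB dV hdV hVA hVB dW hdW).comp (continuous_const.prodMk hι)))

set_option maxHeartbeats 1600000 in -- MEASURED: the `locToAdelic = inclPlaceAdelic` ∕ `hermD = (gramD …).map` defeqs behind the statement time out at 200000 (★ `locToAdelic_cornerLoc`'s class); scoped
/-- **THE PULL-BACK OF A SMOOTH FUNCTION IS SMOOTH**: if `Φ` is right-invariant under an open subgroup `U ≤ H(L⁺_v)` then `u ↦ Φ(B_v(u)·x)` is right-invariant under the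
open subgroup `B_v⁻¹(x U x⁻¹) ≤ H^{(B)}(L⁺_v)` (§2 `continuous_cornerLoc`, ★ `cornerLoc_mul`). [cite: Casselman1980, §3] [cite: HarrisKudlaSweet1996, §1 (1.15)] -/
theorem isSmooth_pullback {Φ : UnitaryGroup.localPi L (IsCMField.complexConj L) (n + n) (hermD L eV dV hdV dW hdW) v → ℂ}
    (hΦ : LocalSiegelDoubled.IsSmooth (Fp L) L (IsCMField.complexConj L) v n Φ)
    (x : UnitaryGroup.localPi L (IsCMField.complexConj L) (n + n) (hermD L eV dV hdV dW hdW) v) :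
    LocalSiegelDoubled.IsSmooth (Fp L) L (IsCMField.complexConj L) v n₂
      (fun u => Φ (UnitaryGroup.evalPlace (Fp L) L (IsCMField.complexConj L) (n + n) (hermD L eV dV hdV dW hdW) v
        (UnitaryGroup.finPart (Fp L) L (IsCMField.complexConj L) (n + n) (hermD L eV dV hdV dW hdW)
          (blkD L eV eA eB dA hdA dB hdB dV hdV hVA hVB dW hdW (1, locToAdelic L eB dB hdB dW hdW v u))) * x)) := by
  obtain ⟨U, hU⟩ := hΦ
  -- the chart as a group homomorphism, conjugated by `x⁻¹`
  obtain ⟨B, hB⟩ : ∃ B : UnitaryGroup.localPi L (IsCMField.complexConj L) (n₂ + n₂) (hermD L eB dB hdB dW hdW) v →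
      UnitaryGroup.localPi L (IsCMField.complexConj L) (n + n) (hermD L eV dV hdV dW hdW) v, ∀ u,
      B u = UnitaryGroup.evalPlace (Fp L) L (IsCMField.complexConj L) (n + n) (hermD L eV dV hdV dW hdW) v
        (UnitaryGroup.finPart (Fp L) L (IsCMField.complexConj L) (n + n) (hermD L eV dV hdV dW hdW)
          (blkD L eV eA eB dA hdA dB hdB dV hdV hVA hVB dW hdW (1, locToAdelic L eB dB hdB dW hdW v u))) := ⟨_, fun _ => rfl⟩
  have hBmul : ∀ u u', B (u * u') = B u * B u' := fun u u' => by
    rw [hB, hB, hB]; exact cornerLoc_mul L eV eA eB dA hdA dB hdB dV hdV hVA hVB dW hdW v u u'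
  have hBc : Continuous B := by
    rw [show B = _ from funext hB]; exact continuous_cornerLoc L eV eA eB dA hdA dB hdB dV hdV hVA hVB dW hdW v
  have hB1 : B 1 = 1 := by
    have h := hBmul 1 1
    rw [mul_one] at h
    exact (mul_eq_left.1 h.symm)
  let f : UnitaryGroup.localPi L (IsCMField.complexConj L) (n₂ + n₂) (hermD L eB dB hdB dW hdW) v →*
      UnitaryGroup.localPi L (IsCMField.complexConj L) (n + n) (hermD L eV dV hdV dW hdW) v :=
    { toFun := fun u => x⁻¹ * B u * x
      map_one' := by rw [hB1, mul_one, inv_mul_cancel]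
      map_mul' := fun u u' => by rw [hBmul]; group }
  have hfc : Continuous f := (continuous_const.mul hBc).mul continuous_const
  let S : Subgroup (UnitaryGroup.localPi L (IsCMField.complexConj L) (n₂ + n₂) (hermD L eB dB hdB dW hdW) v) :=
    (U : Subgroup (UnitaryGroup.localPi L (IsCMField.complexConj L) (n + n) (hermD L eV dV hdV dW hdW) v)).comap f
  have hSo : IsOpen (S : Set (UnitaryGroup.localPi L (IsCMField.complexConj L) (n₂ + n₂) (hermD L eB dB hdB dW hdW) v)) := U.isOpen.preimage hfc
  refine ⟨⟨S, hSo⟩, fun h u hu => ?_⟩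
  have hu' : x⁻¹ * B u * x ∈ (U : Subgroup (UnitaryGroup.localPi L (IsCMField.complexConj L) (n + n) (hermD L eV dV hdV dW hdW) v)) := hu
  show Φ (_ * x) = Φ (_ * x)
  rw [← hB, ← hB, hBmul, show B h * B u * x = (B h * x) * (x⁻¹ * B u * x) by group]
  exact hU (B h * x) _ hu'

set_option maxHeartbeats 1600000 in -- MEASURED: the `locToAdelic = inclPlaceAdelic` ∕ `hermD = (gramD …).map` defeqs behind the statement time out at 200000 (★ `locToAdelic_cornerLoc`'s class); scoped
/-- **THE PULL-BACK LIES IN `I^{(B)}_v(s + n₁∕2, χ_v)`** (★ D10 `localDegPS` = Siegel sections ∧ smooth): §1 + §2. [cite: HarrisKudlaSweet1996, §1 (1.15)] [cite: Kudla1994, §2] -/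
theorem pullback_mem_localDegPS (χ : HeckeCharacter L) (s : ℂ)
    {Φ : UnitaryGroup.localPi L (IsCMField.complexConj L) (n + n) (hermD L eV dV hdV dW hdW) v → ℂ}
    (hΦ : Φ ∈ LocalSiegelDoubled.localDegPS (Fp L) L (IsCMField.complexConj L) (complexConj_imagUnit L) (imagUnit_ne_zero L) (imagUnit_mul_self L)
      v n (gramR_isSymm L eV dV hdV dW hdW) (hermD_eq_map_gramD L eV dV hdV dW hdW) (fun w => χ.localComponent w.1) s)
    (x : UnitaryGroup.localPi L (IsCMField.complexConj L) (n + n) (hermD L eV dV hdV dW hdW) v) :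
    (fun u => Φ (UnitaryGroup.evalPlace (Fp L) L (IsCMField.complexConj L) (n + n) (hermD L eV dV hdV dW hdW) v
        (UnitaryGroup.finPart (Fp L) L (IsCMField.complexConj L) (n + n) (hermD L eV dV hdV dW hdW)
          (blkD L eV eA eB dA hdA dB hdB dV hdV hVA hVB dW hdW (1, locToAdelic L eB dB hdB dW hdW v u))) * x)) ∈
      LocalSiegelDoubled.localDegPS (Fp L) L (IsCMField.complexConj L) (complexConj_imagUnit L) (imagUnit_ne_zero L) (imagUnit_mul_self L)
        v n₂ (gramR_isSymm L eB dB hdB dW hdW) (hermD_eq_map_gramD L eB dB hdB dW hdW) (fun w => χ.localComponent w.1) (s + (n₁ : ℂ) / 2) :=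
  ⟨isLocalSiegelSection_pullback L eV eA eB dA hdA dB hdB dV hdV hVA hVB dW hdW v χ s hΦ.1 x,
    isSmooth_pullback L eV eA eB dA hdA dB hdB dV hdV hVA hVB dW hdW v hΦ.2 x⟩

end Summit.HodgeConjecture.HodgeConjecture.Cruxes.HLiu418.K2LiuKindOneLineLocalPullbackSection

end
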